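import Summits.Langlands.Langlands.Theses.ParityBlindBianchi

/-!
# SketchIdeator2 — crux-ideate stmt-Langlands-16619 (ArtinWeightRealisationEven), ideator 2, round 1

First lemmas of the idea card `adjoint-unitary-host-sign-pinning` (elaboration check only; no proofs).

`QuadraticTwistPinning`: the Galois-side rigidity that lets the p-adic Hecke point of σ pay for the
blind spot of the adjoint: a framed `r : Γ_K → GL₂(ℚ̄_p)` whose Frobenius characteristic polynomials
at the good places are those of `σ` UP TO THE SIGN OF THE TRACE is a quadratic twist of `σ`
(Chebotarev + Brauer–Nesbitt on `Ad`, irreducibility of `Ad⁰σ` for projective image `A₅`, Schur).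

`AdjointSatakeCompatibleAt`: the "adjoint-compatible up to sign" matching between a cuspidal `π` of
`GL₂(𝔸_K)` and `σ` at a place (what adjoint descent from `GL₃` delivers).
-/

namespace Summit.Langlands.Langlands.Cruxes.ArtinWeightRealisationEven.AdjointPinning

open scoped MatrixGroups Matrix Polynomial NumberField Classical
open NumberField IsDedekindDomain Polynomial
open Literature.NumberTheory.Automorphic Literature.NumberTheory.GaloisRepresentations

/-- Pinning lemma (first checkable statement of the line): `r` agrees with `σ` at every good place up to
the sign of the trace ⇒ `r` is conjugate to a quadratic twist of `σ`. -/
def QuadraticTwistPinning : Prop :=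
  ∀ (K : Type) [Field K] [NumberField K] (p : ℕ) [Fact p.Prime]
    (σ r : FramedGaloisRep K (PadicAlgCl p) 2),
    Finite σ.toMonoidHom.range → σ.toGaloisRep.IsIrreducible →
    Nonempty ((Matrix.ProjGenLinGroup.mk.comp σ.toMonoidHom).range ≃* alternatingGroup (Fin 5)) →
    ∀ S₀ : Finset ℕ,
    (∀ v : HeightOneSpectrum (𝓞 K), (∀ ℓ ∈ S₀, ((ℓ : ℕ) : 𝓞 K) ∉ v.asIdeal) →
        σ.IsUnramifiedAt v ∧ r.IsUnramifiedAt v ∧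
        ∃ P : (PadicAlgCl p)[X], σ.HasFrobCharpolyAt v P ∧
          (r.HasFrobCharpolyAt v P ∨ r.HasFrobCharpolyAt v (P.comp (-X)))) →
    ∃ (χ : Field.absoluteGaloisGroup K →* (PadicAlgCl p)ˣ) (M : GL (Fin 2) (PadicAlgCl p)),
      (∀ g, χ g ^ 2 = 1) ∧
      ∀ g : Field.absoluteGaloisGroup K,
        ((r g : GL (Fin 2) (PadicAlgCl p)) : Matrix (Fin 2) (Fin 2) (PadicAlgCl p)) =
          ((χ g : (PadicAlgCl p)ˣ) : PadicAlgCl p) •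
            ((M * σ g * M⁻¹ : GL (Fin 2) (PadicAlgCl p)) : Matrix (Fin 2) (Fin 2) (PadicAlgCl p))

/-- Adjoint-compatible-up-to-sign matching of a `GL₂(𝔸_K)` automorphic `π` with `σ` at `w` through `ι`:
some Satake parameter `α` of `π` at `w` has `arithFrobPolyOfSatake ι q_w 1 α` equal to the Frobenius
characteristic polynomial of `σ` or of `-σ` at `w` (the ambiguity left by `Ad π ≃ Ad⁰σ ⊕ 1` and
`ω_π = det σ`). -/
def AdjointSatakeCompatibleAt {K : Type} [Field K] [NumberField K] {p : ℕ} [Fact p.Prime]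
    {hcpt : isCompact_glFiniteIntegralLevel 2 K} (ι : PadicAlgCl p ≃+* ℂ)
    (π : AutomorphicRepData (AutomorphyDatum.gl 2 K hcpt)) (σ : FramedGaloisRep K (PadicAlgCl p) 2)
    (w : HeightOneSpectrum (𝓞 K)) : Prop :=
  ∃ α : Multiset ℂ, π.HasSatakeParamAt w α ∧ σ.IsUnramifiedAt w ∧
    (σ.HasFrobCharpolyAt w (arithFrobPolyOfSatake ι w.residueCard 1 α) ∨
     σ.HasFrobCharpolyAt w ((arithFrobPolyOfSatake ι w.residueCard 1 α).comp (-X)))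

/-- The realisation step the card isolates downstream of the adjoint host: if a cuspidal `π` on `GL₂/K`
is adjoint-compatible with `σ` at every good place AND its Hecke eigensystem carries a framed Galois
representation `r` matching `π` at every good place (p-adic occurrence of the CLASSICAL `π`, read through
Scholze's determinant), then a quadratic twist of `π` realises `σ` — the twist being GLOBAL by
`QuadraticTwistPinning`. Stated here as the implication the line must prove. -/
def PinnedRealisation : Prop :=
  ∀ (K : Type) [Field K] [NumberField K] (p : ℕ) [Fact p.Prime] (ι : PadicAlgCl p ≃+* ℂ)
    (σ : FramedGaloisRep K (PadicAlgCl p) 2),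
    Finite σ.toMonoidHom.range → σ.toGaloisRep.IsIrreducible →
    Nonempty ((Matrix.ProjGenLinGroup.mk.comp σ.toMonoidHom).range ≃* alternatingGroup (Fin 5)) →
    ∀ S₀ : Finset ℕ, ∀ (hcpt : isCompact_glFiniteIntegralLevel 2 K)
      (π : CuspidalAutomorphicRepData 2 K hcpt) (r : FramedGaloisRep K (PadicAlgCl p) 2),
    (∀ w : HeightOneSpectrum (𝓞 K), (∀ ℓ ∈ S₀, ((ℓ : ℕ) : 𝓞 K) ∉ w.asIdeal) →
        AdjointSatakeCompatibleAt ι π.1 σ w ∧ SatakeFrobCompatibleAt ι π.1 r w) →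
    ∃ (hcpt' : isCompact_glFiniteIntegralLevel 2 K) (π' : CuspidalAutomorphicRepData 2 K hcpt'),
      ∀ w : HeightOneSpectrum (𝓞 K), (∀ ℓ ∈ S₀, ((ℓ : ℕ) : 𝓞 K) ∉ w.asIdeal) →
        SatakeFrobCompatibleAt ι π'.1 σ w

end Summit.Langlands.Langlands.Cruxes.ArtinWeightRealisationEven.AdjointPinning
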